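import Summits.CriticalPhenomena.PercolationContinuityZ3.Theorems.SahiMasterFamilyStructFrames

/-!
# Structure theory of the zero-flag class, IIIb: canonical frames and frames restrict

Unit `prim-master-conj` (crux anchor stmt-CriticalPhenomena-4575); STRUCTURE-THEORY.md §3.3–§3.4 (gen 6).  Consequences of the frame
agreement theorem `frameIn_eq_of_goodChain`: frames are CANONICAL (`frameIn_eq_cframe`: every good chain of a structured family computes
the same frames `cframe U W w`; `biInter_eq_biInter_cframe`: the members multiply to the product of their canonical frames), and FRAMES
RESTRICT (`cframe_erase`: if `W ∖ v` is again structured its frames are those of `W`; `hull_frameSupp_erase`: appending `v` to any good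
chain of `W ∖ v` gives `v` back the frame it has in `W`).  Pure combinatorics; axioms standard. [this work]
-/

noncomputable section

open scoped Classical

namespace Summit.CriticalPhenomena.PercolationContinuityZ3.Theorems

open Finset Function
open Literature.Probability.LatticeModels.Kahn2022 (Affects)

variable {ι : Type*} [Fintype ι] {κ : Type*} (U : κ → Set (Set ι))

/-! ### Canonical frames -/

/-- **Canonical frame** of a member of a structured family: the frame computed by any good chain enumerating the family
(`frameIn_eq_cframe`); junk (the member itself) if the family is not structured. [this work] -/
def cframe (W : Finset κ) (w : κ) : Set (Set ι) :=
  if h : Structured U W then frameIn U (Classical.choose h) w else U w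

/-- **Frames are canonical** (STRUCTURE-THEORY 3.3, A): every good chain of a structured family computes the canonical frames. [this work] -/
theorem frameIn_eq_cframe (hU : ∀ k, IsUpperSet (U k)) (hne : ∀ k, (U k).Nonempty) {l : List κ} (hl : GoodChain U l) {w : κ}
    (hw : w ∈ l) : frameIn U l w = cframe U l.toFinset w := by
  have hs : Structured U l.toFinset := ⟨l, rfl, hl⟩
  rw [cframe, dif_pos hs]
  have hc := Classical.choose_spec hs
  -- the chosen chain enumerates the same family; frame agreement
  refine frameIn_eq_of_goodChain U hU hne hc.2 hl (subset_of_eq hc.1.symm) ?_ hw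
  refine biInter_frameIn_subset_biInter U hc.2 hU l.toFinset (subset_of_eq hc.1.symm) ?_
  rw [hc.1, Finset.sdiff_self, Finset.card_empty]
  exact zero_le_one

/-- The canonical frame is increasing. [this work] -/
theorem isUpperSet_cframe (hU : ∀ k, IsUpperSet (U k)) (W : Finset κ) (w : κ) : IsUpperSet (cframe U W w) := by
  unfold cframe; split_ifs
  · exact isUpperSet_frameIn U hU _ w
  · exact hU w

/-- A member lies in its canonical frame. [this work] -/
theorem subset_cframe (hU : ∀ k, IsUpperSet (U k)) (W : Finset κ) (w : κ) : U w ⊆ cframe U W w := by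
  unfold cframe; split_ifs
  · exact subset_frameIn U hU _ w
  · exact subset_rfl

/-- Canonical frames of distinct members of a structured family have disjoint supports. [this work] -/
theorem disjoint_esupp_cframe (hU : ∀ k, IsUpperSet (U k)) (hne : ∀ k, (U k).Nonempty) {W : Finset κ} (hW : Structured U W)
    {w w' : κ} (hw : w ∈ W) (hw' : w' ∈ W) (h : w ≠ w') : Disjoint (esupp (cframe U W w)) (esupp (cframe U W w')) := by
  obtain ⟨l, hlW, hl⟩ := hW
  subst hlW
  rw [← frameIn_eq_cframe U hU hne hl (List.mem_toFinset.1 hw), ← frameIn_eq_cframe U hU hne hl (List.mem_toFinset.1 hw')]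
  exact disjoint_esupp_frameIn U (GoodChain.nodup U hl) (List.mem_toFinset.1 hw) (List.mem_toFinset.1 hw') h

/-- **The members of a structured family multiply to the product of their canonical frames.** [this work] -/
theorem biInter_eq_biInter_cframe (hU : ∀ k, IsUpperSet (U k)) (hne : ∀ k, (U k).Nonempty) {W : Finset κ} (hW : Structured U W) :
    (⋂ w ∈ W, U w) = ⋂ w ∈ W, cframe U W w := by
  obtain ⟨l, hlW, hl⟩ := hW
  subst hlW
  rw [biInter_eq_biInter_frameIn U hl hU l.toFinset subset_rfl (by simp)]
  exact Set.iInter₂_congr fun w hw => frameIn_eq_cframe U hU hne hl (List.mem_toFinset.1 hw)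

/-! ### Frames restrict -/

/-- **Frames restrict** (STRUCTURE-THEORY 3.4, FR): if `W` and `W ∖ v` are both structured then on `W ∖ v` the canonical frames agree.
[this work] -/
theorem cframe_erase (hU : ∀ k, IsUpperSet (U k)) (hne : ∀ k, (U k).Nonempty) {W : Finset κ} (hW : Structured U W) {v : κ}
    (hWv : Structured U (W.erase v)) {w : κ} (hw : w ∈ W.erase v) : cframe U (W.erase v) w = cframe U W w := by
  obtain ⟨l, hlW, hl⟩ := hW
  obtain ⟨l₂, hl₂W, hl₂⟩ := hWv
  subst hlW
  rw [← hl₂W, ← frameIn_eq_cframe U hU hne hl₂ (List.mem_toFinset.1 (hl₂W.symm ▸ hw)),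
    ← frameIn_eq_cframe U hU hne hl (List.mem_toFinset.1 (mem_of_mem_erase hw))]
  refine frameIn_eq_of_goodChain U hU hne hl hl₂ (by rw [hl₂W]; exact erase_subset _ _) ?_ (List.mem_toFinset.1 (hl₂W.symm ▸ hw))
  rw [hl₂W]
  refine biInter_frameIn_subset_biInter U hl hU _ (erase_subset _ _) ?_
  by_cases hv : v ∈ l.toFinset
  · rw [sdiff_erase hv, Finset.sdiff_self, insert_empty_eq, card_singleton]
  · rw [erase_eq_of_notMem hv, Finset.sdiff_self, Finset.card_empty]; exact zero_le_one

/-- The frame support of a good chain is the union of the supports of the canonical frames. [this work] -/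
theorem frameSupp_eq_biUnion_cframe (hU : ∀ k, IsUpperSet (U k)) (hne : ∀ k, (U k).Nonempty) {l : List κ} (hl : GoodChain U l) :
    frameSupp U l = ⋃ w ∈ l.toFinset, (↑(esupp (cframe U l.toFinset w)) : Set ι) := by
  rw [frameSupp_eq_biUnion U (GoodChain.nodup U hl)]
  exact Set.iUnion₂_congr fun w hw => by rw [frameIn_eq_cframe U hU hne hl (List.mem_toFinset.1 hw)]

/-- **Appending a removed member to any good chain of the rest gives it back its frame** (STRUCTURE-THEORY 3.4, last clause): if `W`
and `W ∖ v` are structured (`v ∈ W`) and `l₂` is a good chain of `W ∖ v`, then `hull (frameSupp U l₂) (U v) = cframe U W v`. [this work] -/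
theorem hull_frameSupp_erase (hU : ∀ k, IsUpperSet (U k)) (hne : ∀ k, (U k).Nonempty) {W : Finset κ} (hW : Structured U W) {v : κ}
    (hv : v ∈ W) {l₂ : List κ} (hl₂W : l₂.toFinset = W.erase v) (hl₂ : GoodChain U l₂) :
    hull (frameSupp U l₂) (U v) = cframe U W v := by
  obtain ⟨l, hlW, hl⟩ := hW
  have hWv : Structured U (W.erase v) := ⟨l₂, hl₂W, hl₂⟩
  -- the frame support of `l₂` is the union of the blocks of `W` other than that of `v`
  have hS : frameSupp U l₂ = ⋃ w ∈ W.erase v, (↑(esupp (cframe U W w)) : Set ι) := by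
    rw [frameSupp_eq_biUnion_cframe U hU hne hl₂, hl₂W]
    exact Set.iUnion₂_congr fun w hw => by rw [cframe_erase U hU hne ⟨l, hlW, hl⟩ hWv hw]
  -- in the chain `l`, `v`'s frame is its hull over any set between the earlier blocks and all other blocks (L2(b))
  subst hlW
  have hvl : v ∈ l := List.mem_toFinset.1 hv
  rw [← frameIn_eq_cframe U hU hne hl hvl]
  have hn := GoodChain.nodup U hl
  obtain ⟨l₁, hl₁⟩ := exists_append_pre hvl
  -- frame of `v` = hull over frameSupp (pre l v); enlarge the opened set to all other blocks
  have hpre : frameIn U l v = frameIn U (v :: pre l v) v := by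
    conv_lhs => rw [hl₁]
    rw [frameIn_append_of_mem U l₁ (hl₁ ▸ hn) (List.mem_cons_self)]
  rw [hpre]
  refine hull_eq_frameIn_head U hU v (pre l v) ?_ ?_
  · -- earlier blocks ⊆ all other blocks
    rw [hS, frameSupp_eq_biUnion U (List.Nodup.of_cons (List.Nodup.of_append_right (hl₁ ▸ hn)))]
    intro i hi
    rw [Set.mem_iUnion₂] at hi ⊢
    obtain ⟨w, hw, hiw⟩ := hi
    have hwl : w ∈ pre l v := List.mem_toFinset.1 hw
    have hwv : w ≠ v := fun h => (List.nodup_cons.1 (List.Nodup.of_append_right (hl₁ ▸ hn))).1 (h ▸ hwl)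
    refine ⟨w, mem_erase.2 ⟨hwv, List.mem_toFinset.2 (pre_subset hvl w hwl)⟩, ?_⟩
    rwa [← frameIn_eq_cframe U hU hne hl (pre_subset hvl w hwl), ← frameIn_pre_eq U hl hvl hwl]
  · -- all other blocks miss the block of `v`
    rw [hS, ← hpre, frameIn_eq_cframe U hU hne hl hvl, Set.disjoint_left]
    intro i hi hiv
    rw [Set.mem_iUnion₂] at hi
    obtain ⟨w, hw, hiw⟩ := hi
    exact Finset.disjoint_left.1 (disjoint_esupp_cframe U hU hne ⟨l, rfl, hl⟩ (mem_of_mem_erase hw) hv (ne_of_mem_erase hw))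
      (mem_coe.1 hiw) (mem_coe.1 hiv)

end Summit.CriticalPhenomena.PercolationContinuityZ3.Theorems
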